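import Mathlib
import HarnessLib
import Summits.NavierStokesRegularity.NavierStokesRegularity.Theorems.ChiralWindowDoorDefs
import Summits.NavierStokesRegularity.NavierStokesRegularity.Theorems.ChiralWindowDoorLambda
import Summits.NavierStokesRegularity.NavierStokesRegularity.Theorems.ChiralWindowDoorFracLapHalfBounds
import Summits.NavierStokesRegularity.NavierStokesRegularity.Theorems.ChiralWindowDoorGagliardoIdentity
import Summits.NavierStokesRegularity.NavierStokesRegularity.Theorems.ChiralWindowDoorLocalHelicityLower
import Summits.NavierStokesRegularity.NavierStokesRegularity.Theorems.ChiralWindowDoorCurlCommutes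
import Summits.NavierStokesRegularity.NavierStokesRegularity.Theorems.ChiralWindowDoorClassDerivDecay

/-!
# Door S20 «ChiralWindowDoor» — B2′ POINTWISE IN TIME: the localised helicity DISSIPATION of a chiral door-class
# slice is almost coercive, `G(a_R, ω(t)) ≤ ∫ a_R⟪ω, curl ω⟫ + e_R(t)`, with the explicit scale-invariant error

Door S20 of nsreg-p1's local Type-I door family (`HOME/ns-regularity-ideate-p1/r19/R19-LINE.md` §B2′, line
`r19/Sketch20v5.lean` 7f13084196f4f031; DESIGN-ONLY, route NOT born).  Stub B2′ `stub_localDissipationLower` is the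
time-integrated version of B1′ for the vorticity `ω = curl v`.  This file proves its POINTWISE-IN-TIME core: for a
chiral door-class profile and every `R > 0`, `t < 0`,

  `gagliardo (bumpSq η R) (curl (v t)) ≤ locHelicity (bumpSq η R) (curl (v t)) + c · R² ∫ (R‖y‖+√(−t))⁻⁴ |Λ a₁(y)| dy`

with `c = ½ ‖curlCLM‖² L₁²` (`L₁` the class's first-order scale-invariant constant), using: the all-orders
scale-invariant package of the class (`…ChiralWindowDoorClassDerivDecay.exists_classical_scaleInvariantBounds_of_class`)
for the regularity of the vorticity slice; `…CurlCommutes.isChiral_curl` (`curl ω = Λω`); the Gagliardo–`Λ` identity;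
the decay `‖ω(t,x)‖ ≤ ‖curlCLM‖ L₁/(‖x‖+√(−t))²` and the exact scaling of `Λ(a_R)` with `x = Ry`.  What remains of B2′
is the one-dimensional time integral `∫_{−∞}^{0} R²(R‖y‖+√(−t))⁻⁴ dt = R²·(R‖y‖)⁻²/3`, which turns the error into
`(c/3)·∫‖y‖⁻²|Λa₁| = (c/3)·c₁(η)` uniformly in `R`.

* `vorticity_slice_regularity` — `ω(t)` is continuous, bounded, Lipschitz, with quadratic second differences, chiral
  if `v(t)` is, and `‖ω(t,x)‖ ≤ ‖curlCLM‖L₁/(‖x‖+√(−t))²`;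
* `integrable_abs_fracLapHalfS_bumpSq_one`, `integral_normSq_vorticity_mul_abs_fracLapHalfS_le` — the bookkeeping;
* `localDissipation_pointwise` — **the pointwise B2′ inequality with the explicit error.**

Seat nsreg-p6 g11 (THEOREMS-ONLY door sequels, DIRECTOR-NS g8 #32 (2)/#36).  WHAT THIS IS NOT: not NS regularity
(Clay A); not yet B2′ (the time integration remains); no route is opened.
-/

noncomputable section

-- the summit and its single sub-problem share the name (CONVENTIONS §1), as in every Theorems file
set_option linter.dupNamespace false

namespace Summit.NavierStokesRegularity.NavierStokesRegularity.Theorems.ChiralWindowDoorLocalDissipationPointwise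

open MeasureTheory Set Filter Topology Metric Function
open scoped RealInnerProductSpace
open Literature.Analysis Literature.Analysis.FluidPDE
open Summit.NavierStokesRegularity.NavierStokesRegularity.Theorems.ChiralWindowDoorDefs
open Summit.NavierStokesRegularity.NavierStokesRegularity.Theorems.ChiralWindowDoorLambda
open Summit.NavierStokesRegularity.NavierStokesRegularity.Theorems.ChiralWindowDoorFracLapHalfBounds
open Summit.NavierStokesRegularity.NavierStokesRegularity.Theorems.ChiralWindowDoorGagliardoIdentity
open Summit.NavierStokesRegularity.NavierStokesRegularity.Theorems.ChiralWindowDoorLocalHelicityLower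
open Summit.NavierStokesRegularity.NavierStokesRegularity.Theorems.ChiralWindowDoorCurlCommutes
open Summit.NavierStokesRegularity.NavierStokesRegularity.Theorems.ChiralWindowDoorClassDerivDecay
  (exists_classical_scaleInvariantBounds_of_class)
open Summit.NavierStokesRegularity.NavierStokesRegularity.Theorems.LocalSineTubeDoorProfileAlignedWindowRigidityAncient
  (analyticOnNhd_slice bdd_of_hasTypeITimeDecay)

/-! ### The vorticity slice of a door-class profile -/

/-- **Regularity, chirality and decay of the vorticity slice.**  For a door-class profile there is `L₁ ≥ 0` such that
for every `t < 0` the vorticity `ω(t) = curl (v t)` is continuous, bounded, Lipschitz, with quadratic second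
differences (some constants depending on `t`), decays like `‖ω(t,x)‖ ≤ ‖curlCLM‖ L₁ / (‖x‖+√(−t))²`, and is chiral
whenever `v(t)` is (`…CurlCommutes.isChiral_curl`). -/
theorem vorticity_slice_regularity {C D : ℝ} {v : ℝ → EuclideanSpace ℝ (Fin 3) → EuclideanSpace ℝ (Fin 3)}
    (hrate : HasTypeITimeDecay C v) (hdecay : HasTypeIDecay D v)
    (hcont : ContinuousOn (Function.uncurry v) (Set.Iio (0 : ℝ) ×ˢ Set.univ))
    (hmild : ∀ s t : ℝ, s < t → t < 0 → ∀ x,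
      v t x = UnboundedOperators.heatExtension (v s) (t - s) x - oseenDuhamel 1 s v v t x)
    (hdiv : ∀ t < 0, VectorCalculus.IsDivFree (v t)) :
    ∃ L₁ : ℝ, 0 ≤ L₁ ∧ ∀ t < (0 : ℝ),
      (∀ x, ‖curl (v t) x‖ ≤ ‖(curlCLM : (EuclideanSpace ℝ (Fin 3) →L[ℝ] EuclideanSpace ℝ (Fin 3)) →L[ℝ]
          EuclideanSpace ℝ (Fin 3))‖ * L₁ / (‖x‖ + Real.sqrt (-t)) ^ 2) ∧
      (IsChiral (v t) → IsChiral (curl (v t))) ∧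
      ∃ N₀ N₁ N₂ : ℝ, Continuous (curl (v t)) ∧ (∀ x, ‖curl (v t) x‖ ≤ N₀) ∧
        (∀ x y, ‖curl (v t) x - curl (v t) y‖ ≤ N₁ * ‖x - y‖) ∧
        ∀ x z, ‖(2 : ℝ) • curl (v t) x - curl (v t) (x + z) - curl (v t) (x - z)‖ ≤ N₂ * ‖z‖ ^ 2 := by
  obtain ⟨Q, -, hSIB⟩ := exists_classical_scaleInvariantBounds_of_class hrate hdecay hcont hmild hdiv
  obtain ⟨L₁, hL₁⟩ := hSIB 1
  obtain ⟨L₂, hL₂⟩ := hSIB 2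
  obtain ⟨L₃, hL₃⟩ := hSIB 3
  set κ : ℝ := ‖(curlCLM : (EuclideanSpace ℝ (Fin 3) →L[ℝ] EuclideanSpace ℝ (Fin 3)) →L[ℝ] EuclideanSpace ℝ (Fin 3))‖
    with hκ
  have hκ0 : 0 ≤ κ :=
    norm_nonneg ((curlCLM : (EuclideanSpace ℝ (Fin 3) →L[ℝ] EuclideanSpace ℝ (Fin 3)) →L[ℝ] EuclideanSpace ℝ (Fin 3)))
  -- `0 ≤ L₁`
  have hL₁nn : 0 ≤ L₁ := by
    have h := (hL₁ (-1) (by norm_num) 0).1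
    have hpos : 0 < (‖(0 : EuclideanSpace ℝ (Fin 3))‖ + Real.sqrt (-(-1 : ℝ))) ^ (1 + 1) := by
      rw [norm_zero, zero_add]; exact pow_pos (Real.sqrt_pos.2 (by norm_num)) _
    by_contra hL
    push Not at hL
    have : L₁ / (‖(0 : EuclideanSpace ℝ (Fin 3))‖ + Real.sqrt (-(-1 : ℝ))) ^ (1 + 1) < 0 := div_neg_of_neg_of_pos hL hpos
    linarith [norm_nonneg (iteratedFDeriv ℝ 1 (v (-1)) 0)]
  refine ⟨L₁, hL₁nn, fun t ht => ?_⟩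
  have hnt : 0 < -t := neg_pos.2 ht
  have hsq : 0 < Real.sqrt (-t) := Real.sqrt_pos.2 hnt
  have han : AnalyticOnNhd ℝ (v t) univ := analyticOnNhd_slice hcont (bdd_of_hasTypeITimeDecay hrate) hmild ht
  have hcd : ContDiff ℝ 3 (v t) := contDiff_iff_contDiffAt.2 fun x => (han x (mem_univ x)).contDiffAt
  -- uniform (in `x`) bounds on the first three derivatives of the slice
  have hden : ∀ (x : EuclideanSpace ℝ (Fin 3)) (n : ℕ), Real.sqrt (-t) ^ n ≤ (‖x‖ + Real.sqrt (-t)) ^ n :=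
    fun x n => pow_le_pow_left₀ hsq.le (by linarith [norm_nonneg x]) n
  have hB : ∀ {L : ℝ} {n : ℕ} (x : EuclideanSpace ℝ (Fin 3)),
      ‖iteratedFDeriv ℝ n (v t) x‖ ≤ L / (‖x‖ + Real.sqrt (-t)) ^ (1 + n) →
        ‖iteratedFDeriv ℝ n (v t) x‖ ≤ |L| / Real.sqrt (-t) ^ (1 + n) := by
    intro L n x h
    refine h.trans ((div_le_div_of_nonneg_right (le_abs_self L) (by positivity)).trans ?_)
    exact div_le_div_of_nonneg_left (abs_nonneg L) (by positivity) (hden x _)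
  have hD1 : ∀ x, ‖fderiv ℝ (v t) x‖ ≤ |L₁| / Real.sqrt (-t) ^ (1 + 1) := fun x => by
    rw [← norm_iteratedFDeriv_one (𝕜 := ℝ)]; exact hB x (hL₁ t ht x).1
  have hD2 : ∀ x, ‖iteratedFDeriv ℝ 2 (v t) x‖ ≤ |L₂| / Real.sqrt (-t) ^ (1 + 2) := fun x => hB x (hL₂ t ht x).1
  have hD3 : ∀ x, ‖iteratedFDeriv ℝ 3 (v t) x‖ ≤ |L₃| / Real.sqrt (-t) ^ (1 + 3) := fun x => hB x (hL₃ t ht x).1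
  have hD0 : ∀ x, ‖v t x‖ ≤ C / Real.sqrt (-t) := fun x => hrate t ht x
  -- the vorticity as `curlCLM ∘ D`
  have hω : curl (v t) = fun x => curlCLM (fderiv ℝ (v t) x) := funext fun x => curl_eq_curlCLM _ _
  refine ⟨fun x => ?_, fun hchi => isChiral_curl hcd hD0 hD1 hD2 hD3 hchi, ?_⟩
  · -- decay
    have h1 := (hL₁ t ht x).1
    rw [norm_iteratedFDeriv_one] at h1
    rw [curl_eq_curlCLM, mul_div_assoc]
    exact (ContinuousLinearMap.le_opNorm _ _).trans (mul_le_mul_of_nonneg_left h1 hκ0)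
  · refine ⟨κ * (|L₁| / Real.sqrt (-t) ^ (1 + 1)), κ * (|L₂| / Real.sqrt (-t) ^ (1 + 2)),
      κ * (2 * (|L₃| / Real.sqrt (-t) ^ (1 + 3))), ?_, fun x => ?_, fun x y => ?_, fun x z => ?_⟩
    · rw [hω]; exact curlCLM.continuous.comp (hcd.continuous_fderiv (by norm_num))
    · rw [curl_eq_curlCLM]
      exact (ContinuousLinearMap.le_opNorm _ _).trans (mul_le_mul_of_nonneg_left (hD1 x) hκ0)
    · -- Lipschitz: mean value on `Df` with `‖D(Df)‖ ≤ |L₂|/√(−t)³`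
      have hdiff2 : Differentiable ℝ (fderiv ℝ (v t)) :=
        (hcd.fderiv_right (m := 2) (by norm_num)).differentiable (by norm_num)
      have hlip : ‖fderiv ℝ (v t) x - fderiv ℝ (v t) y‖ ≤ |L₂| / Real.sqrt (-t) ^ (1 + 2) * ‖x - y‖ :=
        Convex.norm_image_sub_le_of_norm_fderiv_le (fun z _ => hdiff2 z) (fun z _ => norm_fderiv_two_le hD2 z)
          convex_univ (mem_univ y) (mem_univ x)
      rw [curl_eq_curlCLM, curl_eq_curlCLM, ← map_sub, mul_assoc]
      exact (ContinuousLinearMap.le_opNorm _ _).trans (mul_le_mul_of_nonneg_left hlip hκ0)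
    · have h := norm_secondDiff_fderiv_le hcd hD3 x z
      rw [curl_eq_curlCLM, curl_eq_curlCLM, curl_eq_curlCLM, ← map_smul, ← map_sub, ← map_sub, mul_assoc]
      exact (ContinuousLinearMap.le_opNorm _ _).trans (mul_le_mul_of_nonneg_left h hκ0)

/-! ### Bookkeeping: `|Λ a₁|` is integrable; the vorticity-weighted error and its scaling -/

variable {η : EuclideanSpace ℝ (Fin 3) → ℝ}

/-- `|Λ a₁|` is integrable on `ℝ³` (`a₁ = bumpSq η 1`; uniform bound on `B₄(0)`, `16‖a₁‖₁ lamK` beyond). -/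
theorem integrable_abs_fracLapHalfS_bumpSq_one (hη : IsAdmissibleBump η) :
    Integrable (fun y : EuclideanSpace ℝ (Fin 3) => |fracLapHalfS (bumpSq η 1) y|) := by
  obtain ⟨B, hB0, hB, hfar⟩ := exists_bounds_fracLapHalfS_bumpSq_one hη
  set L1 : ℝ := ∫ w, |bumpSq η 1 w| with hL1
  have hL1nn : 0 ≤ L1 := integral_nonneg fun w => abs_nonneg _
  obtain ⟨A₂, hA₂⟩ := exists_secondDiff_bound_bumpSq hη one_pos
  have ha0 : ∀ x, |bumpSq η 1 x| ≤ 1 := fun x => by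
    rw [abs_of_nonneg (bumpSq_nonneg η 1 x)]; exact bumpSq_le_one hη 1 x
  have hΛc : Continuous (fracLapHalfS (bumpSq η 1)) := by
    have h := continuous_secondDiffOp_real (continuous_bumpSq hη 1) ha0 hA₂ 0
    rw [lamKTrunc_zero] at h
    exact continuous_const.mul h
  have hdom : Integrable (fun y : EuclideanSpace ℝ (Fin 3) =>
      (ball (0 : EuclideanSpace ℝ (Fin 3)) 4).indicator (fun _ => B) y + 16 * L1 * lamKTrunc 2 y) := by
    refine Integrable.add ?_ ((integrable_lamKTrunc (by norm_num : (0 : ℝ) < 2)).const_mul _)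
    exact IntegrableOn.integrable_indicator (integrableOn_const (measure_ball_lt_top.ne)) measurableSet_ball
  refine hdom.mono' hΛc.abs.aestronglyMeasurable (ae_of_all _ fun y => ?_)
  rw [Real.norm_eq_abs, abs_abs]
  by_cases hy : y ∈ ball (0 : EuclideanSpace ℝ (Fin 3)) 4
  · rw [indicator_of_mem hy]
    have h2 : 0 ≤ 16 * L1 * lamKTrunc 2 y := by have := lamKTrunc_nonneg 2 y; positivity
    linarith [hB y]
  · rw [indicator_of_notMem hy, zero_add]
    have hy4 : 4 ≤ ‖y‖ := by simpa [mem_ball, dist_zero_right] using hy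
    rw [lamKTrunc_of_lt (show (2 : ℝ) < ‖y‖ by linarith)]
    exact hfar y hy4

/-- **The vorticity-weighted error and its scaling**: if `‖ω x‖ ≤ N/(‖x‖+a)²` (`a > 0`) then for every `R > 0`
`∫ ‖ω x‖² |Λ a_R (x)| dx ≤ N² · R² ∫ ((R‖y‖ + a)⁴)⁻¹ |Λ a₁(y)| dy` (scaling of `Λ a_R` and `x = R y`), and the
right-hand integrand is integrable. -/
theorem integral_normSq_vorticity_mul_abs_fracLapHalfS_le (hη : IsAdmissibleBump η)
    {ω : EuclideanSpace ℝ (Fin 3) → EuclideanSpace ℝ (Fin 3)} {N a : ℝ} (ha : 0 < a)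
    (hω : ∀ x : EuclideanSpace ℝ (Fin 3), ‖ω x‖ ≤ N / (‖x‖ + a) ^ 2) {R : ℝ} (hR : 0 < R) :
    Integrable (fun y : EuclideanSpace ℝ (Fin 3) => ((R * ‖y‖ + a) ^ 4)⁻¹ * |fracLapHalfS (bumpSq η 1) y|) ∧
    ∫ x, ‖ω x‖ ^ 2 * |fracLapHalfS (bumpSq η R) x| ≤
      N ^ 2 * (R ^ 2 * ∫ y : EuclideanSpace ℝ (Fin 3), ((R * ‖y‖ + a) ^ 4)⁻¹ * |fracLapHalfS (bumpSq η 1) y|) := by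
  set m : EuclideanSpace ℝ (Fin 3) → ℝ := fun y => ((R * ‖y‖ + a) ^ 4)⁻¹ * |fracLapHalfS (bumpSq η 1) y| with hm
  have hΛi := integrable_abs_fracLapHalfS_bumpSq_one hη
  -- integrability of `m`: bounded weight times an integrable function
  have hmi : Integrable m := by
    refine (hΛi.const_mul ((a ^ 4)⁻¹)).mono' ?_ (ae_of_all _ fun y => ?_)
    · have hc : Continuous fun y : EuclideanSpace ℝ (Fin 3) => ((R * ‖y‖ + a) ^ 4)⁻¹ :=
        Continuous.inv₀ (by fun_prop) fun y => by positivity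
      exact (hc.aestronglyMeasurable.mul hΛi.aestronglyMeasurable)
    · rw [hm]; dsimp only
      rw [Real.norm_eq_abs, abs_mul, abs_abs, abs_of_nonneg (by positivity)]
      refine mul_le_mul_of_nonneg_right ?_ (abs_nonneg _)
      exact inv_anti₀ (by positivity) (pow_le_pow_left₀ ha.le (by nlinarith [norm_nonneg y, hR.le]) 4)
  refine ⟨hmi, ?_⟩
  have hRi : 0 < R⁻¹ := inv_pos.2 hR
  have hmsi : Integrable (fun x : EuclideanSpace ℝ (Fin 3) => m (R⁻¹ • x)) := hmi.comp_smul hRi.ne'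
  have hval : ∫ x : EuclideanSpace ℝ (Fin 3), m (R⁻¹ • x) = R ^ 3 * ∫ y, m y := by
    rw [Measure.integral_comp_smul volume m R⁻¹, finrank_euclideanSpace_fin,
      abs_of_pos (by positivity : (0 : ℝ) < ((R⁻¹) ^ 3)⁻¹), smul_eq_mul, inv_pow, inv_inv]
  have hN : 0 ≤ N := by
    have h := hω 0
    have hpos : 0 < (‖(0 : EuclideanSpace ℝ (Fin 3))‖ + a) ^ 2 := by positivity
    by_contra hN; push Not at hN
    have : N / (‖(0 : EuclideanSpace ℝ (Fin 3))‖ + a) ^ 2 < 0 := div_neg_of_neg_of_pos hN hpos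
    linarith [norm_nonneg (ω 0)]
  -- pointwise: `‖ω x‖² |Λ a_R x| ≤ N² R⁻¹ m (R⁻¹ x)`
  have hpt : ∀ x : EuclideanSpace ℝ (Fin 3),
      ‖ω x‖ ^ 2 * |fracLapHalfS (bumpSq η R) x| ≤ N ^ 2 * R⁻¹ * m (R⁻¹ • x) := fun x => by
    have hxa : 0 < (‖x‖ + a) ^ 2 := by positivity
    have hfx : ‖ω x‖ ^ 2 ≤ N ^ 2 * ((‖x‖ + a) ^ 4)⁻¹ := by
      calc ‖ω x‖ ^ 2 ≤ (N / (‖x‖ + a) ^ 2) ^ 2 := pow_le_pow_left₀ (norm_nonneg _) (hω x) 2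
        _ = N ^ 2 * ((‖x‖ + a) ^ 4)⁻¹ := by rw [div_pow, ← pow_mul, div_eq_mul_inv]
    have hsc := fracLapHalfS_bumpSq_scale η hR x
    have hnorm : R * ‖R⁻¹ • x‖ + a = ‖x‖ + a := by
      rw [norm_smul, Real.norm_eq_abs, abs_of_pos hRi, ← mul_assoc, mul_inv_cancel₀ hR.ne', one_mul]
    rw [hm]; dsimp only
    rw [hnorm, hsc, abs_mul, abs_of_pos hRi]
    calc ‖ω x‖ ^ 2 * (R⁻¹ * |fracLapHalfS (bumpSq η 1) (R⁻¹ • x)|)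
        ≤ N ^ 2 * ((‖x‖ + a) ^ 4)⁻¹ * (R⁻¹ * |fracLapHalfS (bumpSq η 1) (R⁻¹ • x)|) :=
          mul_le_mul_of_nonneg_right hfx (by positivity)
      _ = N ^ 2 * R⁻¹ * (((‖x‖ + a) ^ 4)⁻¹ * |fracLapHalfS (bumpSq η 1) (R⁻¹ • x)|) := by ring
  calc ∫ x, ‖ω x‖ ^ 2 * |fracLapHalfS (bumpSq η R) x|
      ≤ ∫ x, N ^ 2 * R⁻¹ * m (R⁻¹ • x) :=
        integral_mono_of_nonneg (ae_of_all _ fun x => by positivity) (hmsi.const_mul _) (ae_of_all _ hpt)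
    _ = N ^ 2 * R⁻¹ * (R ^ 3 * ∫ y, m y) := by rw [integral_const_mul, hval]
    _ = N ^ 2 * (R ^ 2 * ∫ y, m y) := by field_simp

/-! ### B2′ pointwise in time -/

/-- **B2′ POINTWISE IN TIME.**  For a chiral door-class profile there is `c ≥ 0` with, for every `R > 0`, `t < 0`,
`gagliardo (bumpSq η R) (curl (v t)) ≤ locHelicity (bumpSq η R) (curl (v t)) + c · R² ∫ (R‖y‖+√(−t))⁻⁴ |Λ a₁(y)| dy`
— the Gagliardo–`Λ` identity for the vorticity slice (chiral by `isChiral_curl`), plus the decay bookkeeping with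
`‖ω(t,x)‖ ≤ ‖curlCLM‖ L₁/(‖x‖+√(−t))²` (`c = ½‖curlCLM‖²L₁²`).  The remaining step of B2′ is the time integral
`∫_{−∞}^{0} R²(R‖y‖+√(−t))⁻⁴ dt = (3‖y‖²)⁻¹`, independent of `R`. -/
theorem localDissipation_pointwise : ∀ (η : EuclideanSpace ℝ (Fin 3) → ℝ), IsAdmissibleBump η → ∀ (C D K : ℝ)
    (v : ℝ → EuclideanSpace ℝ (Fin 3) → EuclideanSpace ℝ (Fin 3)),
    HasTypeITimeDecay C v → HasTypeIDecay D v → HasTypeIDerivDecay K v →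
    ContinuousOn (Function.uncurry v) (Set.Iio (0 : ℝ) ×ˢ Set.univ) →
    (∀ s t : ℝ, s < t → t < 0 → ∀ x,
        v t x = UnboundedOperators.heatExtension (v s) (t - s) x - oseenDuhamel 1 s v v t x) →
    (∀ t < 0, VectorCalculus.IsDivFree (v t)) → (∀ t < 0, IsChiral (v t)) →
    ∃ c : ℝ, 0 ≤ c ∧ ∀ R > (0 : ℝ), ∀ t < (0 : ℝ),
      Integrable (fun y : EuclideanSpace ℝ (Fin 3) =>
        ((R * ‖y‖ + Real.sqrt (-t)) ^ 4)⁻¹ * |fracLapHalfS (bumpSq η 1) y|) ∧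
      gagliardo (bumpSq η R) (curl (v t)) ≤ locHelicity (bumpSq η R) (curl (v t)) +
        c * (R ^ 2 * ∫ y : EuclideanSpace ℝ (Fin 3),
          ((R * ‖y‖ + Real.sqrt (-t)) ^ 4)⁻¹ * |fracLapHalfS (bumpSq η 1) y|) := by
  intro η hη C D K v hrate hdecay _hder hcont hmild hdiv hchi
  obtain ⟨L₁, hL₁, hslice⟩ := vorticity_slice_regularity hrate hdecay hcont hmild hdiv
  set κ : ℝ := ‖(curlCLM : (EuclideanSpace ℝ (Fin 3) →L[ℝ] EuclideanSpace ℝ (Fin 3)) →L[ℝ] EuclideanSpace ℝ (Fin 3))‖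
    with hκ
  refine ⟨(1 / 2 : ℝ) * (κ * L₁) ^ 2, by positivity, fun R hR t ht => ?_⟩
  have hsq : 0 < Real.sqrt (-t) := Real.sqrt_pos.2 (neg_pos.2 ht)
  obtain ⟨hdec, hchiω, N₀, N₁, N₂, hωc, hω0, hω1, hω2⟩ := hslice t ht
  -- the weight
  have hac : Continuous (bumpSq η R) := continuous_bumpSq hη R
  have hann : ∀ x, 0 ≤ bumpSq η R x := bumpSq_nonneg η R
  have ha0 : ∀ x, |bumpSq η R x| ≤ 1 := fun x => by
    rw [abs_of_nonneg (hann x)]; exact bumpSq_le_one hη R x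
  obtain ⟨A₂, hA₂⟩ := exists_secondDiff_bound_bumpSq hη hR
  have hρ : 0 < 2 * R := by positivity
  have hsupp : ∀ x : EuclideanSpace ℝ (Fin 3), 2 * R ≤ ‖x‖ → bumpSq η R x = 0 := fun x hx => bumpSq_eq_zero hη hR hx
  -- the identity in inequality form for the vorticity slice
  have hG := gagliardo_le_integral_add hac hann ha0 hA₂ hρ hsupp hωc hω0 hω1 hω2
  -- chirality of the vorticity
  have hchi' : IsChiral (curl (v t)) := hchiω (hchi t ht)
  have hhel : (∫ x, bumpSq η R x * ⟪curl (v t) x, fracLapHalf (curl (v t)) x⟫) =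
      locHelicity (bumpSq η R) (curl (v t)) := by
    unfold locHelicity
    refine integral_congr_ae (Eventually.of_forall fun x => ?_)
    show bumpSq η R x * ⟪curl (v t) x, fracLapHalf (curl (v t)) x⟫ =
      bumpSq η R x * ⟪curl (v t) x, curl (curl (v t)) x⟫
    rw [← hchi' x]
  -- decay bookkeeping
  have hdec' : ∀ x : EuclideanSpace ℝ (Fin 3), ‖curl (v t) x‖ ≤ (κ * L₁) / (‖x‖ + Real.sqrt (-t)) ^ 2 := hdec
  obtain ⟨hmi, hbook⟩ := integral_normSq_vorticity_mul_abs_fracLapHalfS_le hη hsq hdec' hR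
  refine ⟨hmi, ?_⟩
  rw [hhel] at hG
  calc gagliardo (bumpSq η R) (curl (v t))
      ≤ locHelicity (bumpSq η R) (curl (v t)) +
          (1 / 2 : ℝ) * ∫ x, ‖curl (v t) x‖ ^ 2 * |fracLapHalfS (bumpSq η R) x| := hG
    _ ≤ locHelicity (bumpSq η R) (curl (v t)) + (1 / 2 : ℝ) * ((κ * L₁) ^ 2 * (R ^ 2 *
          ∫ y : EuclideanSpace ℝ (Fin 3), ((R * ‖y‖ + Real.sqrt (-t)) ^ 4)⁻¹ * |fracLapHalfS (bumpSq η 1) y|)) := by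
        gcongr
    _ = _ := by ring

end Summit.NavierStokesRegularity.NavierStokesRegularity.Theorems.ChiralWindowDoorLocalDissipationPointwise
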